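import Literature.NumberTheory.Automorphic.UnitaryGroupKernelClassOrbitalUnfolding
import Literature.MeasureTheory.Group.InvariantQuotientFiniteCovolume
import HarnessLib

/-!
# One `G(F)`-conjugacy class of the quasi-split `U(J_N)` unfolds with the printed constant — NO compactness:
# `∫_X Σ'_{s ∈ [γ₀]} Φ(x̃ s x̃⁻¹) dμ = c_μ · vol(G_{γ₀}(F)\G_{γ₀}(𝔸)) · ∫_{G(𝔸)⧸G_{γ₀}} Φ(y γ₀ y⁻¹) d(ν/ν₀)`
(Arthur, Duke Math. J. 45 (1978), §8; Rogawski (1990), §2.2–2.3, §7.2 Prop. 7.2.1; Gelbart (1975), (9.13), Remark 9.23)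

Topic `NumberTheory/Automorphic`; namespace `Literature.NumberTheory.Automorphic.UnitaryGroup`.  THEOREMS ONLY (no
definition, no instance, no notation, no named fact, no `sorry`).  Cell `pub/hodgecm-mathlib`, ENGINE T1 (crux H413 =
`stmt-HodgeConjecture-24833`), T1-qs road LAW 5, row (L5-iii-b1) part 1 (F0P3a-p05 (g6) GO 11:43:45Z).  ★
`UnitaryGroupKernelClassOrbitalUnfolding` §3 unfolds a whole FIBRE `{cl = 𝔬}` of ELLIPTIC classes with the compact-quotient
binder `hcpt`; the LAW 5 rows need ONE class `[γ₀]` whose centraliser quotient is NOT compact (`γ₀ = d(a,b,a)`: `U(1,1) × U(1)`;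
`γ₀` regular hyperbolic: a split torus).  Over the binder-free brick ★ `lintegral_conjTsum_conjOrbit_eq_covol_mul_of_isClosed`
(`MeasureTheory/Group/InvariantQuotientFiniteCovolume`) and the counting-measure plumbing of ★ §2 of
`UnitaryGroupKernelClassOrbitalUnfolding`, for EVERY `γ₀ ∈ G(F)` and every `N`:

* **`lintegral_conjTsum_conjOrbit_eq_covol_mul_quasiSplit`** — the `[0, ∞]` identity above, `vol` possibly `∞`
  (`c_μ = unfoldingConstant G(F) count μ ν`, `vol = quotientMeasure ((G(F) ⊓ G_{γ₀}).subgroupOf G_{γ₀}) count _ ν₀ univ`);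
* **`integral_conjTsum_conjOrbit_eq_covol_mul_quasiSplit`** — for Borel `f : G(𝔸) → ℂ` with `∫⁻ Σ'_{[γ₀]} ‖f‖ dμ < ∞`:
  integrability of the class sum and of the orbital integrand, and the `ℂ` identity with the constant `(c_μ · vol).toReal`
  (★ `integral_conjTsum_eq_tsum_of_lintegral_complex` at a one-point index).
The finiteness inputs at the singular Borel class (`vol < ∞` ★ `UnitaryGroupSingularCentralizerCovolume`, `O_{γ₀}(‖f‖) < ∞`
★ `UnitaryGroupSplitSemisimpleOrbitalIntegrable`) are plugged in the sequel `UnitaryGroupKernelClassSingularSemisimple`.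
HC_CM is proved only modulo the printed citations until rung 0 closes; this file discharges none of them.

## References
* J. Arthur, *A trace formula for reductive groups I*, Duke Math. J. 45 (1978), §8 [Arthur1978TraceFormulaI].
* J. D. Rogawski, *Automorphic Representations of Unitary Groups in Three Variables*, Ann. of Math. Stud. 123 (1990),
  §2.2 p. 13, §7.2 Prop. 7.2.1 p. 91 [Rogawski1990].
* S. Gelbart, *Automorphic forms on adele groups*, Ann. of Math. Stud. 83 (1975), (9.13), Remark 9.23 [Gelbart1975].
* A. Borel, *Some finiteness properties of adele groups over number fields*, Publ. Math. IHÉS 16 (1963), §5 [Borel1963].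
-/

set_option autoImplicit false

noncomputable section

open MeasureTheory Measure Set Filter Topology
open Literature.MeasureTheory.Group
open scoped NNReal ENNReal Pointwise

namespace Literature.NumberTheory.Automorphic

namespace UnitaryGroup

section OneClass

variable {F E : Type} [Field F] [NumberField F] [Field E] [NumberField E] [Algebra F E]
  {c : E ≃ₐ[F] E} {N : ℕ}

/-- Counting measures restrict to counting measures along an injection of countable types. [folklore] -/
private theorem comap_count_eq_count₁ {α β : Type*} [MeasurableSpace α] [MeasurableSpace β] [Countable α]
    [Countable β] [MeasurableSingletonClass α] [MeasurableSingletonClass β] {f : α → β}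
    (hf : Function.Injective f) : (count : Measure β).comap f = count := by
  refine Measure.ext_of_singleton fun a => ?_
  rw [Measure.comap_apply f hf (fun s _ => (Set.to_countable _).measurableSet) _ (measurableSet_singleton a),
    Set.image_singleton, count_singleton, count_singleton]

/-- … and push forward to counting measures along measurable bijections. [folklore] -/
private theorem map_count_eq_count₁ {α β : Type*} [MeasurableSpace α] [MeasurableSpace β] [Countable α]
    [Countable β] [MeasurableSingletonClass α] [MeasurableSingletonClass β] (e : α ≃ β) (he : Measurable e) :
    (count : Measure α).map e = count := by
  refine Measure.ext_of_singleton fun b => ?_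
  rw [Measure.map_apply he (measurableSet_singleton b), count_singleton]
  have h : (e : α → β) ⁻¹' {b} = {e.symm b} := by
    ext a
    simp only [Set.mem_preimage, Set.mem_singleton_iff, Equiv.apply_eq_iff_eq_symm_apply]
  rw [h, count_singleton]

/-- `A_G·G(F) ∩ C` is discrete and countable, for every subgroup `C ≤ G(𝔸_F)`. [folklore] -/
private theorem discreteTopology_countable_inf_quasiSplit (C : Subgroup (quasiSplit F E c N).Adelic) :
    DiscreteTopology ↥((quasiSplit F E c N).quotientSubgroup ⊓ C) ∧ Countable ↥((quasiSplit F E c N).quotientSubgroup ⊓ C) := by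
  haveI := discreteTopology_quotientSubgroup_quasiSplit (F := F) (E := E) (c := c) (N := N)
  haveI := countable_quotientSubgroup_quasiSplit (F := F) (E := E) (c := c) (N := N)
  have hinj : Function.Injective (fun x : ↥((quasiSplit F E c N).quotientSubgroup ⊓ C) =>
      (⟨(x : (quasiSplit F E c N).Adelic), (Subgroup.mem_inf.1 x.2).1⟩ : (quasiSplit F E c N).quotientSubgroup)) :=
    fun _ _ hab => Subtype.ext (congrArg (fun y : (quasiSplit F E c N).quotientSubgroup => (y : (quasiSplit F E c N).Adelic)) hab)
  exact ⟨DiscreteTopology.of_continuous_injective (continuous_subtype_val.subtype_mk _) hinj, hinj.countable⟩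

/-- `(A_G·G(F) ∩ C).subgroupOf C` is countable (`G(F)` is countable, ★ `countable_quotientSubgroup_quasiSplit`) — the
`Countable`∕`SFinite count` discharger for the centraliser lattices of the one-class unfolding. [cite: Borel1963, §5] -/
theorem countable_quotientSubgroup_inf_subgroupOf_quasiSplit (C : Subgroup (quasiSplit F E c N).Adelic) :
    Countable ↥(((quasiSplit F E c N).quotientSubgroup ⊓ C).subgroupOf C) := by
  haveI := countable_quotientSubgroup_quasiSplit (F := F) (E := E) (c := c) (N := N)
  exact Function.Injective.countable
    (f := fun x : ↥(((quasiSplit F E c N).quotientSubgroup ⊓ C).subgroupOf C) =>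
      (⟨((x : C) : (quasiSplit F E c N).Adelic), (Subgroup.mem_inf.1 (Subgroup.mem_subgroupOf.1 x.2)).1⟩ :
        (quasiSplit F E c N).quotientSubgroup))
    fun _ _ hab => Subtype.ext (Subtype.ext (congrArg (fun y : (quasiSplit F E c N).quotientSubgroup =>
      (y : (quasiSplit F E c N).Adelic)) hab))

/-- **ONE `G(F)`-CONJUGACY CLASS OF THE QUASI-SPLIT DATUM UNFOLDS WITH THE PRINTED CONSTANT — no compactness.**
For `G = U(J_N)(𝔸_F)`, ANY `γ₀ ∈ G(F)` (elliptic or not), an invariant Borel measure `μ ≠ 0` on `X = G(𝔸) ⧸ G(F)` finite on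
compacta, a two-sided Haar measure `ν` on `G(𝔸)` and a two-sided inversion-invariant Haar measure `ν₀` on the adelic
centraliser `G_{γ₀} = C(γ₀)`, for every Borel `Φ ≥ 0`:

  `∫⁻_X Σ'_{s ∈ [γ₀]} Φ(x̃ s x̃⁻¹) dμ = c_μ · vol(G_{γ₀} ⧸ G(F)_{γ₀}) · ∫⁻_{G(𝔸) ⧸ G_{γ₀}} Φ(y γ₀ y⁻¹) d(ν/ν₀)`,

`[γ₀] = conjOrbit G(F) γ₀`, `c_μ = unfoldingConstant G(F) count μ ν`, `vol = quotientMeasure ((G(F) ⊓ G_{γ₀}).subgroupOf G_{γ₀})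
count _ ν₀ (univ)` (possibly `∞`) — ★ `lintegral_conjTsum_conjOrbit_eq_covol_mul_of_isClosed` for `Γ = L = G(F)` with the
counting measures (★ §2 of `UnitaryGroupKernelClassOrbitalUnfolding`). [cite: Gelbart1975, (9.13) and Remark 9.23]
[cite: Arthur1978TraceFormulaI, §8] [cite: Rogawski1990, §2.2 (p. 13)] -/
theorem lintegral_conjTsum_conjOrbit_eq_covol_mul_quasiSplit (γ₀ : (quasiSplit F E c N).arithmeticSubgroup)
    [T2Space (quasiSplit F E c N).Adelic] [LocallyCompactSpace (quasiSplit F E c N).Adelic]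
    [SecondCountableTopology (quasiSplit F E c N).Adelic]
    [MeasurableSpace (quasiSplit F E c N).Adelic] [BorelSpace (quasiSplit F E c N).Adelic]
    [hL : IsClosed (((quasiSplit F E c N).quotientSubgroup : Set (quasiSplit F E c N).Adelic))]
    [hCcl : IsClosed ((Subgroup.centralizer ({(γ₀ : (quasiSplit F E c N).Adelic)} : Set (quasiSplit F E c N).Adelic) :
      Subgroup (quasiSplit F E c N).Adelic) : Set (quasiSplit F E c N).Adelic)]
    [MeasurableSpace ((quasiSplit F E c N).Adelic ⧸ (quasiSplit F E c N).quotientSubgroup)]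
    [BorelSpace ((quasiSplit F E c N).Adelic ⧸ (quasiSplit F E c N).quotientSubgroup)]
    [MeasurableSpace ((quasiSplit F E c N).Adelic ⧸
      Subgroup.centralizer ({(γ₀ : (quasiSplit F E c N).Adelic)} : Set (quasiSplit F E c N).Adelic))]
    [BorelSpace ((quasiSplit F E c N).Adelic ⧸
      Subgroup.centralizer ({(γ₀ : (quasiSplit F E c N).Adelic)} : Set (quasiSplit F E c N).Adelic))]
    [MeasurableSpace (↥(Subgroup.centralizer ({(γ₀ : (quasiSplit F E c N).Adelic)} : Set (quasiSplit F E c N).Adelic)) ⧸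
      ((quasiSplit F E c N).quotientSubgroup ⊓
        Subgroup.centralizer ({(γ₀ : (quasiSplit F E c N).Adelic)} : Set (quasiSplit F E c N).Adelic)).subgroupOf
        (Subgroup.centralizer ({(γ₀ : (quasiSplit F E c N).Adelic)} : Set (quasiSplit F E c N).Adelic)))]
    [BorelSpace (↥(Subgroup.centralizer ({(γ₀ : (quasiSplit F E c N).Adelic)} : Set (quasiSplit F E c N).Adelic)) ⧸
      ((quasiSplit F E c N).quotientSubgroup ⊓
        Subgroup.centralizer ({(γ₀ : (quasiSplit F E c N).Adelic)} : Set (quasiSplit F E c N).Adelic)).subgroupOf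
        (Subgroup.centralizer ({(γ₀ : (quasiSplit F E c N).Adelic)} : Set (quasiSplit F E c N).Adelic)))]
    [(count : Measure ↥(((quasiSplit F E c N).quotientSubgroup ⊓
      Subgroup.centralizer ({(γ₀ : (quasiSplit F E c N).Adelic)} : Set (quasiSplit F E c N).Adelic)).subgroupOf
        (Subgroup.centralizer ({(γ₀ : (quasiSplit F E c N).Adelic)} : Set (quasiSplit F E c N).Adelic)))).IsHaarMeasure]
    [(count : Measure (quasiSplit F E c N).quotientSubgroup).IsHaarMeasure]
    (μ : Measure ((quasiSplit F E c N).Adelic ⧸ (quasiSplit F E c N).quotientSubgroup))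
    [SMulInvariantMeasure (quasiSplit F E c N).Adelic ((quasiSplit F E c N).Adelic ⧸ (quasiSplit F E c N).quotientSubgroup) μ]
    [IsFiniteMeasureOnCompacts μ] (hμ : μ ≠ 0)
    (ν : Measure (quasiSplit F E c N).Adelic) [IsHaarMeasure ν] [ν.IsMulRightInvariant]
    (ν₀ : Measure ↥(Subgroup.centralizer ({(γ₀ : (quasiSplit F E c N).Adelic)} : Set (quasiSplit F E c N).Adelic)))
    [IsHaarMeasure ν₀] [ν₀.IsMulRightInvariant] [ν₀.IsInvInvariant]
    {Φ : (quasiSplit F E c N).Adelic → ℝ≥0∞} (hΦ : Measurable Φ) :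
    ∫⁻ x, conjTsum (quasiSplit F E c N).quotientSubgroup
        (conjOrbit (quasiSplit F E c N).arithmeticSubgroup (γ₀ : (quasiSplit F E c N).Adelic))
        (conj_mem_conjOrbit_of_exists (quasiSplit F E c N).arithmeticSubgroup (quasiSplit F E c N).quotientSubgroup
          (AdelicGroupData.exists_inv_mul_mem_centralizer_quotientSubgroup (quasiSplit F E c N)) γ₀.2) Φ x ∂μ =
      unfoldingConstant (quasiSplit F E c N).quotientSubgroup (count : Measure (quasiSplit F E c N).quotientSubgroup) μ ν *
        quotientMeasure (((quasiSplit F E c N).quotientSubgroup ⊓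
            Subgroup.centralizer ({(γ₀ : (quasiSplit F E c N).Adelic)} : Set (quasiSplit F E c N).Adelic)).subgroupOf
            (Subgroup.centralizer ({(γ₀ : (quasiSplit F E c N).Adelic)} : Set (quasiSplit F E c N).Adelic)))
          count (isClosed_subgroupOf _ _ (hL.inter hCcl)) ν₀ Set.univ *
        ∫⁻ y, descConj (γ₀ : (quasiSplit F E c N).Adelic)
            (Subgroup.centralizer ({(γ₀ : (quasiSplit F E c N).Adelic)} : Set (quasiSplit F E c N).Adelic))
            (fun _ hg => Subgroup.mem_centralizer_singleton_iff.1 hg) Φ y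
          ∂quotientMeasure (Subgroup.centralizer ({(γ₀ : (quasiSplit F E c N).Adelic)} : Set (quasiSplit F E c N).Adelic))
            ν₀ hCcl ν := by
  classical
  haveI : DiscreteTopology (quasiSplit F E c N).quotientSubgroup := discreteTopology_quotientSubgroup_quasiSplit
  haveI : Countable (quasiSplit F E c N).quotientSubgroup := countable_quotientSubgroup_quasiSplit
  haveI : Countable (quasiSplit F E c N).arithmeticSubgroup := countable_arithmeticSubgroup_quasiSplit
  haveI : IsClosed ((((quasiSplit F E c N).quotientSubgroup ⊓ (Subgroup.centralizer ({(γ₀ : (quasiSplit F E c N).Adelic)} : Set (quasiSplit F E c N).Adelic)) : Subgroup (quasiSplit F E c N).Adelic)) :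
      Set (quasiSplit F E c N).Adelic) := hL.inter hCcl
  haveI : DiscreteTopology ↥((quasiSplit F E c N).quotientSubgroup ⊓ (Subgroup.centralizer ({(γ₀ : (quasiSplit F E c N).Adelic)} : Set (quasiSplit F E c N).Adelic))) :=
    (discreteTopology_countable_inf_quasiSplit (Subgroup.centralizer ({(γ₀ : (quasiSplit F E c N).Adelic)} : Set (quasiSplit F E c N).Adelic))).1
  haveI : Countable ↥((quasiSplit F E c N).quotientSubgroup ⊓ (Subgroup.centralizer ({(γ₀ : (quasiSplit F E c N).Adelic)} : Set (quasiSplit F E c N).Adelic))) :=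
    (discreteTopology_countable_inf_quasiSplit (Subgroup.centralizer ({(γ₀ : (quasiSplit F E c N).Adelic)} : Set (quasiSplit F E c N).Adelic))).2
  haveI : Countable ↥(((quasiSplit F E c N).quotientSubgroup ⊓ (Subgroup.centralizer ({(γ₀ : (quasiSplit F E c N).Adelic)} : Set (quasiSplit F E c N).Adelic))).subgroupOf (Subgroup.centralizer ({(γ₀ : (quasiSplit F E c N).Adelic)} : Set (quasiSplit F E c N).Adelic))) :=
    countable_quotientSubgroup_inf_subgroupOf_quasiSplit (Subgroup.centralizer ({(γ₀ : (quasiSplit F E c N).Adelic)} : Set (quasiSplit F E c N).Adelic))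
  haveI : (count : Measure ↥((quasiSplit F E c N).quotientSubgroup ⊓ (Subgroup.centralizer ({(γ₀ : (quasiSplit F E c N).Adelic)} : Set (quasiSplit F E c N).Adelic)))).IsHaarMeasure :=
    isHaarMeasure_count_of_discrete
  -- the restricted counting measures are counting measures
  have hρH : (count : Measure ↥((quasiSplit F E c N).quotientSubgroup ⊓ (Subgroup.centralizer ({(γ₀ : (quasiSplit F E c N).Adelic)} : Set (quasiSplit F E c N).Adelic)))) =
      (count : Measure (quasiSplit F E c N).quotientSubgroup).comap
        (Subgroup.inclusion (le_of_mem_iff (quasiSplit F E c N).quotientSubgroup _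
          (fun g => mem_inf_centralizer_singleton_iff _ _ g))) :=
    (comap_count_eq_count₁ (Subgroup.inclusion_injective _)).symm
  have hρF : (count : Measure ↥(((quasiSplit F E c N).quotientSubgroup ⊓ (Subgroup.centralizer ({(γ₀ : (quasiSplit F E c N).Adelic)} : Set (quasiSplit F E c N).Adelic))).subgroupOf (Subgroup.centralizer ({(γ₀ : (quasiSplit F E c N).Adelic)} : Set (quasiSplit F E c N).Adelic)))) =
      Measure.map (Subgroup.subgroupOfEquivOfLe (inf_le_right : (quasiSplit F E c N).quotientSubgroup ⊓ (Subgroup.centralizer ({(γ₀ : (quasiSplit F E c N).Adelic)} : Set (quasiSplit F E c N).Adelic)) ≤ _)).symm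
        (count : Measure ↥((quasiSplit F E c N).quotientSubgroup ⊓ (Subgroup.centralizer ({(γ₀ : (quasiSplit F E c N).Adelic)} : Set (quasiSplit F E c N).Adelic)))) :=
    (map_count_eq_count₁ (Subgroup.subgroupOfEquivOfLe inf_le_right).symm.toEquiv
      (continuous_subgroupOfEquivOfLe_symm _ _ inf_le_right).measurable).symm
  -- relative openness of `G(F)_γ₀` in the discrete `G(F)` (trivial central retraction)
  have hc0 : (quasiSplit F E c N).center' = ⊥ := rfl
  have hθA : ∀ g : (quasiSplit F E c N).Adelic,
      (1 : (quasiSplit F E c N).Adelic →* (quasiSplit F E c N).Adelic) g ∈ (quasiSplit F E c N).center' := fun g => by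
    rw [MonoidHom.one_apply]; exact one_mem _
  have hθa : ∀ a ∈ (quasiSplit F E c N).center',
      (1 : (quasiSplit F E c N).Adelic →* (quasiSplit F E c N).Adelic) a = a := fun a ha => by
    rw [hc0, Subgroup.mem_bot] at ha
    rw [ha, MonoidHom.one_apply]
  have hopen := AdelicGroupData.isOpen_subgroupOf_quotientSubgroup_of_center'_le (quasiSplit F E c N)
      isDiscreteRational_quasiSplit 1 continuous_const hθA hθa (fun _ _ => rfl)
      (AdelicGroupData.center'_le_inf_centralizer (quasiSplit F E c N) (γ₀ : (quasiSplit F E c N).Adelic))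
  have key := lintegral_conjTsum_conjOrbit_eq_covol_mul_of_isClosed
    (quasiSplit F E c N).arithmeticSubgroup (quasiSplit F E c N).quotientSubgroup
    (quasiSplit F E c N).arithmeticSubgroup_le_quotientSubgroup
    (AdelicGroupData.exists_inv_mul_mem_centralizer_quotientSubgroup (quasiSplit F E c N)) γ₀.2
    ((quasiSplit F E c N).quotientSubgroup ⊓ (Subgroup.centralizer ({(γ₀ : (quasiSplit F E c N).Adelic)} : Set (quasiSplit F E c N).Adelic))) (Subgroup.centralizer ({(γ₀ : (quasiSplit F E c N).Adelic)} : Set (quasiSplit F E c N).Adelic)) (fun g => mem_inf_centralizer_singleton_iff _ _ g) inf_le_right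
    (fun _ hg => Subgroup.mem_centralizer_singleton_iff.1 hg) μ ν
    (count : Measure (quasiSplit F E c N).quotientSubgroup)
    (count : Measure ↥((quasiSplit F E c N).quotientSubgroup ⊓ (Subgroup.centralizer ({(γ₀ : (quasiSplit F E c N).Adelic)} : Set (quasiSplit F E c N).Adelic))))
    (count : Measure ↥(((quasiSplit F E c N).quotientSubgroup ⊓ (Subgroup.centralizer ({(γ₀ : (quasiSplit F E c N).Adelic)} : Set (quasiSplit F E c N).Adelic))).subgroupOf (Subgroup.centralizer ({(γ₀ : (quasiSplit F E c N).Adelic)} : Set (quasiSplit F E c N).Adelic)))) ν₀ hopen hμ hρH hρF hΦ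
  exact key

/-- **The same for complex integrands** (the trace-formula form): for every Borel `f : G(𝔸) → ℂ` with
`∫⁻_X Σ'_{s ∈ [γ₀]} ‖f(x̃ s x̃⁻¹)‖ dμ < ∞` (e.g. `lintegral_conjTsum_conjOrbit_singular_lt_top_cm`), the class sum
`[x] ↦ Σ'_{s ∈ [γ₀]} f(x̃ s x̃⁻¹)` is `μ`-integrable, the orbital integrand `y ↦ f(y γ₀ y⁻¹)` is `ν/ν₀`-integrable, and
`∫_X Σ'_{s ∈ [γ₀]} f(x̃ s x̃⁻¹) dμ = (c_μ · vol).toReal · ∫_{G(𝔸) ⧸ G_{γ₀}} f(y γ₀ y⁻¹) d(ν/ν₀)` — §1 passed to `ℂ` by ★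
`integral_conjTsum_eq_tsum_of_lintegral_complex` with the single index `d = c_μ · vol ≠ 0`.
[cite: Gelbart1975, (9.13) and Remark 9.23] [cite: Arthur1978TraceFormulaI, §8] -/
theorem integral_conjTsum_conjOrbit_eq_covol_mul_quasiSplit (γ₀ : (quasiSplit F E c N).arithmeticSubgroup)
    [T2Space (quasiSplit F E c N).Adelic] [LocallyCompactSpace (quasiSplit F E c N).Adelic]
    [SecondCountableTopology (quasiSplit F E c N).Adelic]
    [MeasurableSpace (quasiSplit F E c N).Adelic] [BorelSpace (quasiSplit F E c N).Adelic]
    [hL : IsClosed (((quasiSplit F E c N).quotientSubgroup : Set (quasiSplit F E c N).Adelic))]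
    [hCcl : IsClosed ((Subgroup.centralizer ({(γ₀ : (quasiSplit F E c N).Adelic)} : Set (quasiSplit F E c N).Adelic) :
      Subgroup (quasiSplit F E c N).Adelic) : Set (quasiSplit F E c N).Adelic)]
    [MeasurableSpace ((quasiSplit F E c N).Adelic ⧸ (quasiSplit F E c N).quotientSubgroup)]
    [BorelSpace ((quasiSplit F E c N).Adelic ⧸ (quasiSplit F E c N).quotientSubgroup)]
    [MeasurableSpace ((quasiSplit F E c N).Adelic ⧸
      Subgroup.centralizer ({(γ₀ : (quasiSplit F E c N).Adelic)} : Set (quasiSplit F E c N).Adelic))]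
    [BorelSpace ((quasiSplit F E c N).Adelic ⧸
      Subgroup.centralizer ({(γ₀ : (quasiSplit F E c N).Adelic)} : Set (quasiSplit F E c N).Adelic))]
    [MeasurableSpace (↥(Subgroup.centralizer ({(γ₀ : (quasiSplit F E c N).Adelic)} : Set (quasiSplit F E c N).Adelic)) ⧸
      ((quasiSplit F E c N).quotientSubgroup ⊓
        Subgroup.centralizer ({(γ₀ : (quasiSplit F E c N).Adelic)} : Set (quasiSplit F E c N).Adelic)).subgroupOf
        (Subgroup.centralizer ({(γ₀ : (quasiSplit F E c N).Adelic)} : Set (quasiSplit F E c N).Adelic)))]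
    [BorelSpace (↥(Subgroup.centralizer ({(γ₀ : (quasiSplit F E c N).Adelic)} : Set (quasiSplit F E c N).Adelic)) ⧸
      ((quasiSplit F E c N).quotientSubgroup ⊓
        Subgroup.centralizer ({(γ₀ : (quasiSplit F E c N).Adelic)} : Set (quasiSplit F E c N).Adelic)).subgroupOf
        (Subgroup.centralizer ({(γ₀ : (quasiSplit F E c N).Adelic)} : Set (quasiSplit F E c N).Adelic)))]
    [(count : Measure ↥(((quasiSplit F E c N).quotientSubgroup ⊓
      Subgroup.centralizer ({(γ₀ : (quasiSplit F E c N).Adelic)} : Set (quasiSplit F E c N).Adelic)).subgroupOf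
        (Subgroup.centralizer ({(γ₀ : (quasiSplit F E c N).Adelic)} : Set (quasiSplit F E c N).Adelic)))).IsHaarMeasure]
    [(count : Measure (quasiSplit F E c N).quotientSubgroup).IsHaarMeasure]
    (μ : Measure ((quasiSplit F E c N).Adelic ⧸ (quasiSplit F E c N).quotientSubgroup))
    [SMulInvariantMeasure (quasiSplit F E c N).Adelic ((quasiSplit F E c N).Adelic ⧸ (quasiSplit F E c N).quotientSubgroup) μ]
    [IsFiniteMeasureOnCompacts μ] (hμ : μ ≠ 0)
    (ν : Measure (quasiSplit F E c N).Adelic) [IsHaarMeasure ν] [ν.IsMulRightInvariant]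
    (ν₀ : Measure ↥(Subgroup.centralizer ({(γ₀ : (quasiSplit F E c N).Adelic)} : Set (quasiSplit F E c N).Adelic)))
    [IsHaarMeasure ν₀] [ν₀.IsMulRightInvariant] [ν₀.IsInvInvariant]
    {f : (quasiSplit F E c N).Adelic → ℂ} (hf : Measurable f)
    (hfin : ∫⁻ x, conjTsum (quasiSplit F E c N).quotientSubgroup
        (conjOrbit (quasiSplit F E c N).arithmeticSubgroup (γ₀ : (quasiSplit F E c N).Adelic))
        (conj_mem_conjOrbit_of_exists (quasiSplit F E c N).arithmeticSubgroup (quasiSplit F E c N).quotientSubgroup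
          (AdelicGroupData.exists_inv_mul_mem_centralizer_quotientSubgroup (quasiSplit F E c N)) γ₀.2) (fun g => ‖f g‖ₑ) x ∂μ < ∞) :
    Integrable (conjTsum (quasiSplit F E c N).quotientSubgroup
        (conjOrbit (quasiSplit F E c N).arithmeticSubgroup (γ₀ : (quasiSplit F E c N).Adelic))
        (conj_mem_conjOrbit_of_exists (quasiSplit F E c N).arithmeticSubgroup (quasiSplit F E c N).quotientSubgroup
          (AdelicGroupData.exists_inv_mul_mem_centralizer_quotientSubgroup (quasiSplit F E c N)) γ₀.2) f) μ ∧
    Integrable (descConj (γ₀ : (quasiSplit F E c N).Adelic)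
            (Subgroup.centralizer ({(γ₀ : (quasiSplit F E c N).Adelic)} : Set (quasiSplit F E c N).Adelic))
            (fun _ hg => Subgroup.mem_centralizer_singleton_iff.1 hg) f) (quotientMeasure (Subgroup.centralizer ({(γ₀ : (quasiSplit F E c N).Adelic)} : Set (quasiSplit F E c N).Adelic))
            ν₀ hCcl ν) ∧
    ∫ x, conjTsum (quasiSplit F E c N).quotientSubgroup
        (conjOrbit (quasiSplit F E c N).arithmeticSubgroup (γ₀ : (quasiSplit F E c N).Adelic))
        (conj_mem_conjOrbit_of_exists (quasiSplit F E c N).arithmeticSubgroup (quasiSplit F E c N).quotientSubgroup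
          (AdelicGroupData.exists_inv_mul_mem_centralizer_quotientSubgroup (quasiSplit F E c N)) γ₀.2) f x ∂μ =
      (((unfoldingConstant (quasiSplit F E c N).quotientSubgroup (count : Measure (quasiSplit F E c N).quotientSubgroup) μ ν : ℝ≥0∞) *
        quotientMeasure (((quasiSplit F E c N).quotientSubgroup ⊓
            Subgroup.centralizer ({(γ₀ : (quasiSplit F E c N).Adelic)} : Set (quasiSplit F E c N).Adelic)).subgroupOf
            (Subgroup.centralizer ({(γ₀ : (quasiSplit F E c N).Adelic)} : Set (quasiSplit F E c N).Adelic)))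
          count (isClosed_subgroupOf _ _ (hL.inter hCcl)) ν₀ Set.univ).toReal : ℂ) *
        ∫ y, descConj (γ₀ : (quasiSplit F E c N).Adelic)
            (Subgroup.centralizer ({(γ₀ : (quasiSplit F E c N).Adelic)} : Set (quasiSplit F E c N).Adelic))
            (fun _ hg => Subgroup.mem_centralizer_singleton_iff.1 hg) f y ∂quotientMeasure (Subgroup.centralizer ({(γ₀ : (quasiSplit F E c N).Adelic)} : Set (quasiSplit F E c N).Adelic))
            ν₀ hCcl ν := by
  classical
  haveI : Countable (quasiSplit F E c N).arithmeticSubgroup := countable_arithmeticSubgroup_quasiSplit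
  haveI : Countable ↥(conjOrbit (quasiSplit F E c N).arithmeticSubgroup (γ₀ : (quasiSplit F E c N).Adelic)) := countable_conjOrbit _ _
  haveI : DiscreteTopology (quasiSplit F E c N).quotientSubgroup := discreteTopology_quotientSubgroup_quasiSplit
  -- the single constant `d = c_μ · vol ≠ 0`
  have hρ0 : (count : Measure (quasiSplit F E c N).quotientSubgroup) ≠ 0 := fun h0 => by
    have h1 : (count : Measure (quasiSplit F E c N).quotientSubgroup) {1} = 0 := by rw [h0]; rfl
    rw [count_singleton] at h1
    exact one_ne_zero h1
  have hc : 0 < unfoldingConstant (quasiSplit F E c N).quotientSubgroup (count : Measure (quasiSplit F E c N).quotientSubgroup) μ ν := unfoldingConstant_pos _ _ μ ν hμ hρ0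
  have hd0 : ∀ _ : Unit, (unfoldingConstant (quasiSplit F E c N).quotientSubgroup (count : Measure (quasiSplit F E c N).quotientSubgroup) μ ν : ℝ≥0∞) *
      quotientMeasure (((quasiSplit F E c N).quotientSubgroup ⊓
            Subgroup.centralizer ({(γ₀ : (quasiSplit F E c N).Adelic)} : Set (quasiSplit F E c N).Adelic)).subgroupOf
            (Subgroup.centralizer ({(γ₀ : (quasiSplit F E c N).Adelic)} : Set (quasiSplit F E c N).Adelic)))
          count (isClosed_subgroupOf _ _ (hL.inter hCcl)) ν₀ Set.univ ≠ 0 :=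
    fun _ => mul_ne_zero (ENNReal.coe_ne_zero.2 hc.ne') (Measure.measure_univ_ne_zero.2 (quotientMeasure_ne_zero _ _ _ _))
  have hId : ∀ Φ : (quasiSplit F E c N).Adelic → ℝ≥0∞, Measurable Φ →
      ∫⁻ x, conjTsum (quasiSplit F E c N).quotientSubgroup
        (conjOrbit (quasiSplit F E c N).arithmeticSubgroup (γ₀ : (quasiSplit F E c N).Adelic))
        (conj_mem_conjOrbit_of_exists (quasiSplit F E c N).arithmeticSubgroup (quasiSplit F E c N).quotientSubgroup
          (AdelicGroupData.exists_inv_mul_mem_centralizer_quotientSubgroup (quasiSplit F E c N)) γ₀.2) Φ x ∂μ =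
        ∑' _ : Unit, (unfoldingConstant (quasiSplit F E c N).quotientSubgroup (count : Measure (quasiSplit F E c N).quotientSubgroup) μ ν : ℝ≥0∞) *
          quotientMeasure (((quasiSplit F E c N).quotientSubgroup ⊓
            Subgroup.centralizer ({(γ₀ : (quasiSplit F E c N).Adelic)} : Set (quasiSplit F E c N).Adelic)).subgroupOf
            (Subgroup.centralizer ({(γ₀ : (quasiSplit F E c N).Adelic)} : Set (quasiSplit F E c N).Adelic)))
          count (isClosed_subgroupOf _ _ (hL.inter hCcl)) ν₀ Set.univ *
          ∫⁻ y, descConj (γ₀ : (quasiSplit F E c N).Adelic)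
            (Subgroup.centralizer ({(γ₀ : (quasiSplit F E c N).Adelic)} : Set (quasiSplit F E c N).Adelic))
            (fun _ hg => Subgroup.mem_centralizer_singleton_iff.1 hg) Φ y ∂quotientMeasure (Subgroup.centralizer ({(γ₀ : (quasiSplit F E c N).Adelic)} : Set (quasiSplit F E c N).Adelic))
            ν₀ hCcl ν := by
    intro Φ hΦ
    rw [tsum_fintype, Fintype.sum_unique]
    exact lintegral_conjTsum_conjOrbit_eq_covol_mul_quasiSplit γ₀ μ hμ ν ν₀ hΦ
  have key := integral_conjTsum_eq_tsum_of_lintegral_complex (quasiSplit F E c N).quotientSubgroup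
    (conjOrbit (quasiSplit F E c N).arithmeticSubgroup (γ₀ : (quasiSplit F E c N).Adelic))
    (conj_mem_conjOrbit_of_exists (quasiSplit F E c N).arithmeticSubgroup (quasiSplit F E c N).quotientSubgroup
      (AdelicGroupData.exists_inv_mul_mem_centralizer_quotientSubgroup (quasiSplit F E c N)) γ₀.2) μ
    (fun _ : Unit => (γ₀ : (quasiSplit F E c N).Adelic))
    (fun _ : Unit => Subgroup.centralizer ({(γ₀ : (quasiSplit F E c N).Adelic)} : Set (quasiSplit F E c N).Adelic))
    (fun _ => fun _ hg => Subgroup.mem_centralizer_singleton_iff.1 hg)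
    (fun _ : Unit => quotientMeasure (Subgroup.centralizer ({(γ₀ : (quasiSplit F E c N).Adelic)} : Set (quasiSplit F E c N).Adelic))
            ν₀ hCcl ν)
    hd0 hId hf hfin
  obtain ⟨hint, hdesc, -, heq⟩ := key
  refine ⟨hint, hdesc (), ?_⟩
  rw [heq, tsum_fintype, Fintype.sum_unique]

end OneClass


end UnitaryGroup

end Literature.NumberTheory.Automorphic
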